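import Mathlib.LinearAlgebra.Matrix.Charpoly.Coeff
import Mathlib.LinearAlgebra.Charpoly.ToMatrix
import Mathlib.LinearAlgebra.Charpoly.BaseChange
import Mathlib.LinearAlgebra.PerfectPairing.Basic
import Mathlib.LinearAlgebra.Dual.Basis
import Mathlib.Algebra.Polynomial.Reverse
import Mathlib.Algebra.Polynomial.Degree.Lemmas
import Mathlib.Algebra.Polynomial.Eval.Degree
import Mathlib.Algebra.Polynomial.FieldDivision
import Mathlib.Analysis.SpecialFunctions.Pow.Real
import Mathlib.Tactic.LinearCombination
import Mathlib.Tactic.FieldSimp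
import Literature.NumberTheory.LFunctions.WeilConjectures
import Literature.AlgebraicGeometry.Motives.FrobeniusTraceProofs
import HarnessLib

/-!
# Grothendieck's functional equation of the zeta function — the cohomological proof

This file proves Grothendieck's functional equation of `Z(X, T)` for `X` smooth projective of
dimension `n` over a finite field `k = 𝔽_q`, in the form of the named fact
`Literature.NumberTheory.LFunctions.hasFunctionalEquation_zetaSeries`
(`Literature/NumberTheory/LFunctions/WeilConjectures.lean`), *from the cohomological formalism*:
for every Weil cohomology theory with Galois action
`E : Literature.GaloisWeilCohomology k K χ` (accepted prelude `GaloisRealization`, coefficients `K` of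
characteristic zero) which

* satisfies the Grothendieck–Lefschetz trace formula `E.HasLefschetzTraceFormula`
  (`#X(𝔽_{q^m}) = ∑ᵢ (-1)ⁱ tr(Fᵐ | Hⁱ(X))`, `F` the geometric Frobenius; accepted prelude
  `FrobeniusTrace`), and
* whose twisting character takes the value `q` on the arithmetic Frobenius,
  `χ(φ) = q` (the normalisation of the cyclotomic character, so that `F` acts on `H²ⁿ(X) ≅ K`
  as multiplication by `qⁿ`),

the fact `hasFunctionalEquation_zetaSeries` holds over `k`:
`Literature.NumberTheory.LFunctions.hasFunctionalEquation_zetaSeries_of_galoisWeilCohomology`. For `ℓ`-adic étale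
cohomology (`ℓ ∤ q`) both hypotheses are theorems of Grothendieck (SGA 4, 4½, 5); granting the
existence of that theory, this is exactly the printed proof of the functional equation
(Grothendieck, Sém. Bourbaki 279, §5; Deligne, *Weil I*, (2.6): "C'est là la formulation de
Grothendieck de l'équation fonctionnelle des fonctions Z"; Hartshorne, App. C, Thm. 4.4;
Kahn, Thm. 3.65). The closed discharge `hasFunctionalEquation_zetaSeries_holds` therefore
reduces to the existence of `ℓ`-adic cohomology as a `GaloisWeilCohomology` with the trace
formula, which neither Mathlib nor the Literature tree constructs.

## The printed proof and its formalisation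

Hartshorne, *Algebraic Geometry*, App. C, Lemma 4.3 and Thm. 4.4 (pp. 456–457), equivalently
Kahn, *Zeta and L-functions of varieties and motives*, (3.6.4)–(3.6.6):

1. (*Lemma 4.3, linear algebra.*) If `V × W → K` is a perfect pairing of finite-dimensional
   vector spaces and `φ ∈ End V`, `ψ ∈ End W` satisfy `⟨φ v, ψ w⟩ = λ ⟨v, w⟩`, then
   `det(1 - ψ t; W) = (-1)^r λ^r t^r det(φ; V)⁻¹ det(1 - φ/(λt); V)`, `r = dim V`. We prove it in
   the polynomial form `charpoly(φ)(λT) = (-1)^r det(φ) · det(1 - T ψ)`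
   (`charpoly_comp_C_mul_X_of_pairing`), from the matrix identity
   `Aᵀ B = λ · 1 ⟹ charpoly(A)(λT) = (-1)^r det(A) · charpolyRev(B)`
   (`charpoly_comp_C_mul_X_of_transpose_mul_eq`: `det A · det(1 - T B) = det(Aᵀ - λT·1)`).
2. (*Thm. 4.4, cohomology.*) Poincaré duality `Hⁱ(X) × H²ⁿ⁻ⁱ(X) → H²ⁿ(X) → K`
   (`E.isPerfPair_cupPairing`), compatibility of `F` with cup products (`E.cup_ρ`) and
   `F = qⁿ` on `H²ⁿ(X)` (`E.trace_ρ`, `E.bijective_trace` and `χ(φ) = q`) give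
   `⟨F v, F w⟩ = qⁿ ⟨v, w⟩` (`cupPairing_frobAction`, Kahn (3.6.4)), hence by step 1 the
   duality `Pᵢ^rev(qⁿ T) = (-1)^{bᵢ} det(F | Hⁱ) · P₂ₙ₋ᵢ(T)` of the polynomials
   `Pᵢ(T) = det(1 - T F | Hⁱ(X))` (`reverse_frobCharPoly_comp`, Kahn (3.6.5), Deligne (2.4):
   the eigenvalues of `F` on `H²ⁿ⁻ⁱ` are the `qⁿ/α`). Consequently `A = ∏_{i odd} Pᵢ` and
   `B = ∏_{i even} Pᵢ` are *self-dual*: `A^rev(qⁿ T) = a · A(T)`, `B^rev(qⁿ T) = b · B(T)`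
   (`reverse_prod_frobCharPoly_comp`, re-indexing `i ↦ 2n - i`).
3. (*Thm. 4.4, algebra.*) For self-dual `A`, `B` with nonzero constant terms the rational
   function `Z = A/B` satisfies `Z(1/(qⁿT)) = c · T^χ · Z(T)` with `χ = deg B - deg A` and
   `c² = q^{nχ}`, in the cross-multiplied form of `Literature.AlgebraicGeometry.Motives.HasFunctionalEquation`
   (`functionalEquation_of_reverse_comp_eq`, `functionalEquation_const_sq`; comparing extreme
   coefficients gives `a² = q^{n deg A}`, `b² = q^{n deg B}`).
4. (*Assembly.*) `Z(X, T) · B = A` in `K⟦T⟧` is the cohomological expression of the zeta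
   function (`E.zetaSeries_mul_prod_frobCharPoly_holds`, Grothendieck 1965, Cor. 5.2, proved in
   `FrobeniusTraceProofs`). The cross-multiplied functional equation is independent of the
   presentation `Z = A/B` (`functionalEquation_transfer`), so it transfers to any rational
   presentation — the one furnished by a Weil factorisation `Z · ∏_{even} Pᵢ = ∏_{odd} Pᵢ`,
   `Pᵢ ∈ ℤ[T]`, for the named fact, or the one produced by `exists_rat_presentation`
   (`ℚ⟦T⟧ ∩ K(T) = ℚ(T)`: Hartshorne, after Thm. 4.2; Deligne (1.7) ⟹ (1.6)) in general — whose
   Euler characteristic `deg B - deg A` is the same integer (`natDegree_sub_natDegree_eq`); the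
   constant `c ∈ K` is then rational (`exists_eq_C_mul_of_map_eq`), `c² = q^{nχ}` in `ℚ`, so
   `c = ε q^{nχ/2}` in `ℝ` with `ε = ±1` (`exists_sign_eq_rpow`), which is
   `HasFunctionalEquation q n (zetaSeries X) χ` (`hasFunctionalEquation_of_map`).

## Main results

* `Literature.NumberTheory.LFunctions.WeilFunctionalEquation.charpoly_comp_C_mul_X_of_transpose_mul_eq`,
  `Literature.NumberTheory.LFunctions.WeilFunctionalEquation.charpoly_comp_C_mul_X_of_pairing`: Hartshorne, App. C, Lemma 4.3.
* `Literature.NumberTheory.LFunctions.WeilFunctionalEquation.functionalEquation_of_reverse_comp_eq`,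
  `…functionalEquation_const_sq`, `…functionalEquation_transfer`: the functional equation of
  `A/B` for self-dual `A`, `B`, its constant, and its independence of the presentation.
* `Literature.NumberTheory.LFunctions.WeilFunctionalEquation.hasFunctionalEquation_of_map`: `HasFunctionalEquation q n Z χ` for
  a rational `Z = A/B` admitting a self-dual presentation over an extension `K ⊇ ℚ`.
* `Literature.NumberTheory.LFunctions.WeilFunctionalEquation.cupPairing_frobAction`, `…reverse_frobCharPoly_comp`: Kahn
  (3.6.4), (3.6.5) for a `GaloisWeilCohomology` with `χ(φ) = q`.
* `Literature.NumberTheory.LFunctions.WeilFunctionalEquation.exists_rat_presentation`: a rational power series which is a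
  rational function over an extension field `K ⊇ ℚ` is a rational function over `ℚ`
  (`ℚ⟦T⟧ ∩ K(T) = ℚ(T)`, by applying a `ℚ`-linear functional to the coefficients).
* `Literature.AlgebraicGeometry.Motives.GaloisWeilCohomology.exists_polynomial_mul_zetaSeries_eq_of_hasLefschetzTraceFormula`,
  `Literature.AlgebraicGeometry.Motives.GaloisWeilCohomology.hasFunctionalEquation_zetaSeries_of_hasLefschetzTraceFormula`:
  Grothendieck's rationality and functional equation for `Z(X, T)`, `X` smooth projective, for a
  Galois Weil cohomology theory with the trace formula (and `χ(φ) = q`), with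
  `χ(X) = ∑ (-1)ⁱ dim Hⁱ(X)` (Deligne (2.6); Kahn Thm. 3.65) — unconditional in any Weil
  factorisation.
* `Literature.NumberTheory.LFunctions.hasFunctionalEquation_zetaSeries_of_galoisWeilCohomology`: the reduction of the named
  fact `Literature.NumberTheory.LFunctions.hasFunctionalEquation_zetaSeries` to the existence of a Galois Weil cohomology
  theory over `k` with the Lefschetz trace formula and `χ(φ) = q`.

## References

* A. Grothendieck, *Formule de Lefschetz et rationalité des fonctions L*, Sém. Bourbaki 279
  (1964/65), §5. [Grothendieck1965] (not held; acquisition request acq-00639)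
* P. Deligne, *La conjecture de Weil. I*, Publ. Math. IHÉS 43 (1974), (1.5.4), (2.3), (2.4),
  (2.6), pp. 276, 281–282. [Deligne1974]
* R. Hartshorne, *Algebraic Geometry* (1977), App. C, Thm. 1.2 (p. 450), Lemma 4.3 and
  Thm. 4.4 (pp. 456–457). [Hartshorne1977]
* B. Kahn, *Zeta and L-functions of varieties and motives*, LMS LNS 462 (2020), Thm. 3.65 and
  (3.6.4)–(3.6.6). [Kahn2020]

## Design notes

* The file introduces no definitions; helper lemmas live in `namespace Literature.WeilFunctionalEquation`.
* Everything up to `hasFunctionalEquation_of_map` is pure (linear) algebra over a field and does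
  not mention schemes; only the section `Cohomology` uses the `GaloisWeilCohomology` axioms
  (`finite_obj`, `isPerfPair_cupPairing`, `cup_ρ`, `trace_ρ`) and the proved cohomological
  expression of `Z(X, T)`.
* The hypothesis `(χ (arithFrob k) : K) = Nat.card k` is the only link between the abstract
  twisting character `χ` of `GaloisWeilCohomology k K χ` and `q`; for `ℓ`-adic cohomology
  `χ` is the cyclotomic character and the hypothesis is its defining property on Frobenius.
* The parity of `nχ` (Deligne (2.6): `nχ` is even) is not needed: the constant `c` is shown to
  be rational with `c² = q^{nχ}`, and `|c| = q^{nχ/2}` is taken in `ℝ` (`Real.rpow`), exactly as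
  `Literature.AlgebraicGeometry.Motives.HasFunctionalEquation` is phrased.
* In the section `Cohomology` the scheme is called `Y` because `X` denotes the polynomial
  variable.
-/

universe u v

open Polynomial Matrix

noncomputable section

namespace Literature.NumberTheory.LFunctions

namespace WeilFunctionalEquation

/-! ### Hartshorne, App. C, Lemma 4.3, matrix form -/

section MatrixLemma

variable {K : Type*} [CommRing K] {ι : Type*} [Fintype ι] [DecidableEq ι]

/-- **Hartshorne, App. C, Lemma 4.3, matrix form.** If `Aᵀ B = c · 1` for square matrices
`A`, `B` over a commutative ring, then `charpoly(A)(cT) = (-1)^r det(A) · det(1 - T·B)`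
(`r` the size; `det(1 - T·B) = Matrix.charpolyRev B`). Proof:
`det A · det(1 - T B) = det(Aᵀ) det(1 - T B) = det(Aᵀ - T AᵀB) = det(Aᵀ - cT·1) = det(A - cT·1)
= (-1)^r det(cT·1 - A)`. [cite: Hartshorne1977, App. C Lemma 4.3] -/
theorem charpoly_comp_C_mul_X_of_transpose_mul_eq (A B : Matrix ι ι K) (c : K)
    (h : Aᵀ * B = c • (1 : Matrix ι ι K)) :
    A.charpoly.comp (C c * X) = (-1) ^ Fintype.card ι * C A.det * B.charpolyRev := by
  -- the composite `charpoly(A)(cT) = det (cT·1 - A)`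
  have h1 : A.charpoly.comp (C c * X) =
      ((C c * X) • (1 : Matrix ι ι K[X]) - A.map C).det := by
    rw [Matrix.charpoly, ← coe_compRingHom_apply, RingHom.map_det, RingHom.mapMatrix_apply]
    congr 1
    ext i j
    by_cases hij : i = j
    · subst hij
      simp
    · simp [hij]
  -- `det A · det (1 - T·B) = det (Aᵀ - cT·1)`
  have h2 : C A.det * B.charpolyRev = (Aᵀ.map C - (C c * X) • (1 : Matrix ι ι K[X])).det := by
    rw [Matrix.charpolyRev, RingHom.map_det, RingHom.mapMatrix_apply, ← det_transpose (A.map C),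
      ← transpose_map, ← det_mul, mul_sub, mul_one, Matrix.mul_smul, ← Matrix.map_mul, h,
      Matrix.map_smul' _ c _ C.map_mul, Matrix.map_one C C.map_zero C.map_one, smul_smul,
      mul_comm X]
  have h3 : (Aᵀ.map C - (C c * X) • (1 : Matrix ι ι K[X])) =
      -((C c * X) • (1 : Matrix ι ι K[X]) - A.map C)ᵀ := by
    rw [transpose_sub, transpose_smul, transpose_one, transpose_map, neg_sub]
  rw [h1, mul_assoc, h2, h3, det_neg, det_transpose, ← mul_assoc, ← pow_add, ← two_mul,
    pow_mul, neg_one_sq, one_pow, one_mul]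

/-- If `Aᵀ B = c · 1` with `c ≠ 0` over a domain then `det A ≠ 0` (`det Aᵀ · det B = c^r`).
[folklore] -/
theorem det_ne_zero_of_transpose_mul_eq [IsDomain K] (A B : Matrix ι ι K) {c : K} (hc : c ≠ 0)
    (h : Aᵀ * B = c • (1 : Matrix ι ι K)) : A.det ≠ 0 := by
  intro hA
  have := congrArg Matrix.det h
  rw [det_mul, det_transpose, hA, zero_mul, det_smul, det_one, mul_one] at this
  exact pow_ne_zero _ hc this.symm

end MatrixLemma

/-! ### Hartshorne, App. C, Lemma 4.3, for a perfect pairing -/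

section Pairing

variable {K : Type*} [Field K] {V W : Type*} [AddCommGroup V] [Module K V] [AddCommGroup W]
  [Module K W] [FiniteDimensional K V] [FiniteDimensional K W]

/-- **Hartshorne, App. C, Lemma 4.3** (Kahn 2020, proof of (3.6.5)). Let `p : V × W → K` be a
perfect pairing of finite-dimensional vector spaces and `φ ∈ End V`, `ψ ∈ End W` with
`⟨φ v, ψ w⟩ = c ⟨v, w⟩` for all `v, w`. Then
`charpoly(φ)(cT) = (-1)^{dim V} det(φ) · det(1 - T ψ; W)` (printed form:
`det(1 - ψ t; W) = (-1)^r cʳ tʳ det(φ; V)⁻¹ det(1 - φ/(ct); V)`), and `det φ ≠ 0` if `c ≠ 0`.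
Proof: in a basis of `V` and the `p`-dual basis of `W` the matrices satisfy
`Aᵀ B = c · 1`; apply `charpoly_comp_C_mul_X_of_transpose_mul_eq`.
[cite: Hartshorne1977, App. C Lemma 4.3] [cite: Kahn2020, (3.6.5)] -/
theorem charpoly_comp_C_mul_X_of_pairing (p : V →ₗ[K] W →ₗ[K] K) [p.IsPerfPair]
    (φ : V →ₗ[K] V) (ψ : W →ₗ[K] W) (c : K) (h : ∀ v w, p (φ v) (ψ w) = c * p v w) :
    φ.charpoly.comp (C c * X) =
      (-1) ^ Module.finrank K V * C (LinearMap.det φ) * ψ.charpoly.reverse ∧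
    (c ≠ 0 → LinearMap.det φ ≠ 0) := by
  classical
  -- a basis of `V` and the dual basis of `W`
  set bV := Module.finBasis K V
  set e : W ≃ₗ[K] Module.Dual K V := p.flip.toPerfPair
  set bW : Module.Basis (Fin (Module.finrank K V)) K W := bV.dualBasis.map e.symm with hbW
  have hdual : ∀ v j, p v (bW j) = bV.repr v j := by
    intro v j
    have : p v (bW j) = e (bW j) v := rfl
    rw [this, hbW, Module.Basis.map_apply, LinearEquiv.apply_symm_apply,
      Module.Basis.dualBasis_apply]
  have hAB :
      (LinearMap.toMatrix bV bV φ)ᵀ * LinearMap.toMatrix bW bW ψ = c • (1 : Matrix _ _ K) := by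
    ext i j
    have hij := h (bV i) (bW j)
    rw [hdual, Module.Basis.repr_self, Finsupp.single_apply] at hij
    -- expand `ψ (bW j)` in the basis `bW`
    have hexp : p (φ (bV i)) (ψ (bW j)) =
        ∑ l, LinearMap.toMatrix bW bW ψ l j * bV.repr (φ (bV i)) l := by
      conv_lhs => rw [← bW.sum_repr (ψ (bW j))]
      rw [map_sum]
      refine Finset.sum_congr rfl fun l _ => ?_
      rw [LinearMap.map_smul, smul_eq_mul, hdual, LinearMap.toMatrix_apply]
    rw [Matrix.mul_apply, Matrix.smul_apply, Matrix.one_apply, smul_eq_mul, ← hij, hexp]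
    refine Finset.sum_congr rfl fun l _ => ?_
    rw [Matrix.transpose_apply, LinearMap.toMatrix_apply, mul_comm]
  have key := charpoly_comp_C_mul_X_of_transpose_mul_eq _ _ c hAB
  rw [LinearMap.charpoly_toMatrix, LinearMap.det_toMatrix, ← Matrix.reverse_charpoly,
    LinearMap.charpoly_toMatrix, Fintype.card_fin] at key
  refine ⟨key, fun hc => ?_⟩
  have := det_ne_zero_of_transpose_mul_eq _ _ hc hAB
  rwa [LinearMap.det_toMatrix] at this

end Pairing

section PolynomialAlgebra

variable {K : Type*} [Field K]

/-- A polynomial with nonzero constant term is the reverse of its reverse. [folklore] -/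
theorem reverse_reverse_of_coeff_zero_ne_zero {f : K[X]} (hf : f.coeff 0 ≠ 0) :
    f.reverse.reverse = f := by
  have h0 : f.natTrailingDegree = 0 := natTrailingDegree_eq_zero.mpr (Or.inr hf)
  have hd : f.reverse.natDegree = f.natDegree := by rw [reverse_natDegree, h0, Nat.sub_zero]
  rw [reverse, hd, reverse, reflect_reflect]

/-- `deg f(aT) ≤ deg f`. [folklore] -/
theorem natDegree_comp_C_mul_X_le (f : K[X]) (a : K) :
    (f.comp (C a * X)).natDegree ≤ f.natDegree := by
  refine natDegree_comp_le.trans ?_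
  rcases eq_or_ne a 0 with rfl | ha
  · simp
  · rw [natDegree_C_mul_X a ha, mul_one]

/-- `reflect N f = T^{N-d} · reflect d f` for `deg f ≤ d ≤ N`. [folklore] -/
theorem reflect_eq_X_pow_mul_reflect {f : K[X]} {d N : ℕ} (hf : f.natDegree ≤ d) (hd : d ≤ N) :
    reflect N f = X ^ (N - d) * reflect d f := by
  have h := reflect_mul f 1 hf (show (1 : K[X]).natDegree ≤ N - d by simp)
  rwa [mul_one, Nat.add_sub_cancel' hd, reflect_one, mul_comm] at h

/-- `T^d f(1/(cT)) = c^{-d} · f^rev(cT)` for `d = deg f`, `c ≠ 0`, where `f^rev(T) = T^d f(1/T)` is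
`Polynomial.reverse f`: the two normal forms of the substitution `T ↦ 1/(qⁿT)` (Hartshorne, App. C,
(1.2) and proof of Thm. 4.4). [folklore] -/
theorem reflect_comp_C_inv_mul_X {c : K} (hc : c ≠ 0) (f : K[X]) :
    reflect f.natDegree (f.comp (C c⁻¹ * X)) =
      C (c⁻¹ ^ f.natDegree) * f.reverse.comp (C c * X) := by
  ext m
  rw [coeff_reflect, comp_C_mul_X_coeff, coeff_C_mul, comp_C_mul_X_coeff, coeff_reverse]
  rcases le_or_gt m f.natDegree with hm | hm
  · rw [revAt_le hm, show c⁻¹ ^ f.natDegree = c⁻¹ ^ (f.natDegree - m) * c⁻¹ ^ m by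
      rw [← pow_add, Nat.sub_add_cancel hm], mul_assoc, mul_left_comm (c⁻¹ ^ m), inv_pow c m,
      inv_mul_cancel₀ (pow_ne_zero m hc), mul_one, mul_comm]
  · rw [revAt_eq_self_of_lt hm, coeff_eq_zero_of_natDegree_lt hm, zero_mul, zero_mul, mul_zero]

/-- `T^{F+G} (fg)(c/T) = T^F f(c/T) · T^G g(c/T)` for `deg f ≤ F`, `deg g ≤ G`
(`Polynomial.reflect_mul`). [folklore] -/
theorem reflect_comp_mul {c : K} {f g : K[X]} {F G : ℕ} (hf : f.natDegree ≤ F)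
    (hg : g.natDegree ≤ G) :
    reflect (F + G) ((f * g).comp (C c * X)) =
      reflect F (f.comp (C c * X)) * reflect G (g.comp (C c * X)) := by
  rw [mul_comp]
  exact reflect_mul _ _ ((natDegree_comp_C_mul_X_le f c).trans hf)
    ((natDegree_comp_C_mul_X_le g c).trans hg)

/-- If `A(0) ≠ 0` and `A` is *self-dual* for `c`, `A^rev(cT) = a · A(T)`, then comparing constant
and leading coefficients gives `a · A(0) = lead A`, `a² = c^{deg A}` and `a ≠ 0` (Hartshorne,
App. C, proof of Thm. 4.4: `det(f*; H^{2n-i}) det(f*; Hⁱ) = q^{n Bᵢ}`; Kahn 2020, line after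
(3.6.5)).
[cite: Kahn2020, (3.6.5)] -/
theorem sq_eq_pow_of_reverse_comp_eq {c a : K} {A : K[X]} (hA0 : A.coeff 0 ≠ 0)
    (hA : A.reverse.comp (C c * X) = C a * A) :
    a * A.coeff 0 = A.leadingCoeff ∧ a ^ 2 = c ^ A.natDegree ∧ a ≠ 0 := by
  have h0 := congrArg (fun p : K[X] => p.coeff 0) hA
  simp only [comp_C_mul_X_coeff, coeff_zero_reverse, pow_zero, mul_one, coeff_C_mul] at h0
  have hd := congrArg (fun p : K[X] => p.coeff A.natDegree) hA
  simp only [comp_C_mul_X_coeff, coeff_reverse, coeff_C_mul, revAt_le le_rfl, Nat.sub_self,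
    coeff_natDegree] at hd
  have hA' : A ≠ 0 := fun h => hA0 (by rw [h, coeff_zero])
  refine ⟨h0.symm, ?_, ?_⟩
  · have : a ^ 2 * A.coeff 0 = c ^ A.natDegree * A.coeff 0 := by
      calc a ^ 2 * A.coeff 0 = a * (a * A.coeff 0) := by ring
        _ = a * A.leadingCoeff := by rw [← h0]
        _ = A.coeff 0 * c ^ A.natDegree := hd.symm
        _ = c ^ A.natDegree * A.coeff 0 := mul_comm _ _
    exact mul_right_cancel₀ hA0 this
  · rintro rfl
    rw [zero_mul] at h0
    exact leadingCoeff_ne_zero.mpr hA' h0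

/-- **The functional equation of `A/B` for self-dual `A`, `B`** (the algebra in Hartshorne, App. C,
Thm. 4.4 / Kahn 2020, (3.6.5) ⟹ (3.6.6)). If `c ≠ 0`, `B(0) ≠ 0`, `A^rev(cT) = a A(T)` and
`B^rev(cT) = b B(T)`, then for `N ≥ deg A, deg B`, `χ = deg B - deg A`, `Ã(T) = T^N A(1/(cT))`,
`B̃(T) = T^N B(1/(cT))`:
`T^{χ⁻} · Ã · B = (c^{-deg A} a / (c^{-deg B} b)) · T^{χ⁺} · A · B̃`, i.e.
`(A/B)(1/(cT)) = const · T^χ · (A/B)(T)` cross-multiplied as in `Literature.AlgebraicGeometry.Motives.HasFunctionalEquation`.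
[cite: Hartshorne1977, App. C Thm. 4.4] [cite: Kahn2020, (3.6.6)] -/
theorem functionalEquation_of_reverse_comp_eq {c a b : K} (hc : c ≠ 0) {A B : K[X]}
    (hB0 : B.coeff 0 ≠ 0)
    (hA : A.reverse.comp (C c * X) = C a * A) (hB : B.reverse.comp (C c * X) = C b * B)
    {N : ℕ} (hAN : A.natDegree ≤ N) (hBN : B.natDegree ≤ N) :
    X ^ (-((B.natDegree : ℤ) - A.natDegree)).toNat * reflect N (A.comp (C c⁻¹ * X)) * B =
      C (c⁻¹ ^ A.natDegree * a / (c⁻¹ ^ B.natDegree * b)) *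
        X ^ ((B.natDegree : ℤ) - A.natDegree).toNat * A * reflect N (B.comp (C c⁻¹ * X)) := by
  obtain ⟨-, -, hb⟩ := sq_eq_pow_of_reverse_comp_eq hB0 hB
  rw [reflect_eq_X_pow_mul_reflect (natDegree_comp_C_mul_X_le A c⁻¹) hAN,
    reflect_eq_X_pow_mul_reflect (natDegree_comp_C_mul_X_le B c⁻¹) hBN,
    reflect_comp_C_inv_mul_X hc A, reflect_comp_C_inv_mul_X hc B, hA, hB]
  have he : (-((B.natDegree : ℤ) - A.natDegree)).toNat + (N - A.natDegree) =
      ((B.natDegree : ℤ) - A.natDegree).toNat + (N - B.natDegree) := by omega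
  have hβ : c⁻¹ ^ B.natDegree * b ≠ 0 := mul_ne_zero (pow_ne_zero _ (inv_ne_zero hc)) hb
  have hq : C (c⁻¹ ^ A.natDegree * a / (c⁻¹ ^ B.natDegree * b)) * (C (c⁻¹ ^ B.natDegree) * C b) =
      C (c⁻¹ ^ A.natDegree) * C a := by
    rw [← C_mul, ← C_mul, ← C_mul, div_mul_cancel₀ _ hβ]
  calc X ^ (-((B.natDegree : ℤ) - A.natDegree)).toNat *
        (X ^ (N - A.natDegree) * (C (c⁻¹ ^ A.natDegree) * (C a * A))) * B
      = X ^ ((-((B.natDegree : ℤ) - A.natDegree)).toNat + (N - A.natDegree)) *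
          (C (c⁻¹ ^ A.natDegree) * C a) * (A * B) := by ring
    _ = X ^ (((B.natDegree : ℤ) - A.natDegree).toNat + (N - B.natDegree)) *
          (C (c⁻¹ ^ A.natDegree * a / (c⁻¹ ^ B.natDegree * b)) *
            (C (c⁻¹ ^ B.natDegree) * C b)) * (A * B) := by rw [he, hq]
    _ = _ := by ring

/-- The constant of `functionalEquation_of_reverse_comp_eq` satisfies
`const² · c^{deg A} = c^{deg B}`, i.e. `const² = c^χ` (Hartshorne, App. C, Thm. 4.4: the factor
`q^{nE/2}` up to sign; Kahn 2020, (3.6.6)). [cite: Kahn2020, (3.6.6)] -/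
theorem functionalEquation_const_sq {c a b : K} (hc : c ≠ 0) {A B : K[X]}
    (hA0 : A.coeff 0 ≠ 0) (hB0 : B.coeff 0 ≠ 0)
    (hA : A.reverse.comp (C c * X) = C a * A) (hB : B.reverse.comp (C c * X) = C b * B) :
    (c⁻¹ ^ A.natDegree * a / (c⁻¹ ^ B.natDegree * b)) ^ 2 * c ^ A.natDegree = c ^ B.natDegree := by
  obtain ⟨-, ha2, ha⟩ := sq_eq_pow_of_reverse_comp_eq hA0 hA
  obtain ⟨-, hb2, hb⟩ := sq_eq_pow_of_reverse_comp_eq hB0 hB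
  rw [div_pow, mul_pow, mul_pow, ha2, hb2, inv_pow c, inv_pow c]
  field_simp

/-- **Independence of the presentation.** The cross-multiplied functional equation
`T^{e₁} Ã B = const · T^{e₂} A B̃` for `Z = A/B` (`A, B ≠ 0`, `N ≥ deg A, deg B`) implies the same
identity for any other presentation `Z = A'/B'` (`A' B = A B'`, `N' ≥ deg A', deg B'`): multiply by
`A' B̃'`, use `Ã' B̃ = Ã B̃'` and cancel `A B̃ ≠ 0` (this is the remark "the identity is independent
of the choices of `A`, `B`, `N`" in the docstring of `Literature.AlgebraicGeometry.Motives.HasFunctionalEquation`). [folklore] -/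
theorem functionalEquation_transfer {c q : K} (hc : c ≠ 0) {A B A' B' : K[X]} {e₁ e₂ N N' : ℕ}
    (hA : A ≠ 0) (hB : B ≠ 0)
    (hAN : A.natDegree ≤ N) (hBN : B.natDegree ≤ N) (hAN' : A'.natDegree ≤ N')
    (hBN' : B'.natDegree ≤ N')
    (hx : A' * B = A * B')
    (hfe : X ^ e₁ * reflect N (A.comp (C c⁻¹ * X)) * B =
      C q * X ^ e₂ * A * reflect N (B.comp (C c⁻¹ * X))) :
    X ^ e₁ * reflect N' (A'.comp (C c⁻¹ * X)) * B' =
      C q * X ^ e₂ * A' * reflect N' (B'.comp (C c⁻¹ * X)) := by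
  -- `Ã' · B̃ = Ã · B̃'`
  have hstar : reflect N' (A'.comp (C c⁻¹ * X)) * reflect N (B.comp (C c⁻¹ * X)) =
      reflect N (A.comp (C c⁻¹ * X)) * reflect N' (B'.comp (C c⁻¹ * X)) := by
    rw [← reflect_comp_mul hAN' hBN, hx, add_comm, reflect_comp_mul hAN hBN']
  have hm : A * reflect N (B.comp (C c⁻¹ * X)) ≠ 0 := by
    refine mul_ne_zero hA ?_
    rw [Ne, reflect_eq_zero_iff,
      comp_C_mul_X_eq_zero_iff (mem_nonZeroDivisors_of_ne_zero (inv_ne_zero hc))]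
    exact hB
  refine mul_right_cancel₀ hm ?_
  linear_combination (X ^ e₁ * A * B') * hstar - (X ^ e₁ * reflect N (A.comp (C c⁻¹ * X)) *
    reflect N' (B'.comp (C c⁻¹ * X))) * hx + (A' * reflect N' (B'.comp (C c⁻¹ * X))) * hfe

/-- The coercion `R[T] → R⟦T⟧` is multiplicative on finite products. [folklore] -/
theorem coe_prod {R : Type*} [CommSemiring R] {ι : Type*} (s : Finset ι) (f : ι → R[X]) :
    ((∏ i ∈ s, f i : R[X]) : PowerSeries R) = ∏ i ∈ s, (f i : PowerSeries R) :=
  map_prod (Polynomial.coeToPowerSeries.ringHom (R := R)) f s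

/-- Over a field, `reverse` is multiplicative on finite products
(`Polynomial.reverse_mul_of_domain`). [folklore] -/
theorem reverse_prod {ι : Type*} (s : Finset ι) (f : ι → K[X]) :
    (∏ i ∈ s, f i).reverse = ∏ i ∈ s, (f i).reverse := by
  classical
  induction s using Finset.induction_on with
  | empty => rw [Finset.prod_empty, Finset.prod_empty, ← C_1, reverse_C]
  | insert i s hi ih =>
    rw [Finset.prod_insert hi, Finset.prod_insert hi, reverse_mul_of_domain, ih]

end PolynomialAlgebra

/-! ### Descent of the functional equation from `K` to `ℚ` and `ℝ` -/

section Descent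

variable {K : Type*} [Field K] [CharZero K]

/-- Descent of a proportionality: if `L, R ∈ ℚ[T]`, `R ≠ 0`, and `L = q_K · R` in `K[T]` for some
`q_K ∈ K ⊇ ℚ`, then `q_K ∈ ℚ` and `L = q_K · R` in `ℚ[T]` (compare a nonzero coefficient).
[folklore] -/
theorem exists_eq_C_mul_of_map_eq {L R : ℚ[X]} {qK : K} (hR : R ≠ 0)
    (h : L.map (algebraMap ℚ K) = C qK * R.map (algebraMap ℚ K)) :
    ∃ q₀ : ℚ, algebraMap ℚ K q₀ = qK ∧ L = C q₀ * R := by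
  have hj : R.coeff R.natDegree ≠ 0 := leadingCoeff_ne_zero.mpr hR
  have hcoeff := congrArg (fun p : K[X] => p.coeff R.natDegree) h
  simp only [coeff_map, coeff_C_mul] at hcoeff
  have hj' : algebraMap ℚ K (R.coeff R.natDegree) ≠ 0 := (_root_.map_ne_zero _).mpr hj
  refine ⟨L.coeff R.natDegree / R.coeff R.natDegree, ?_, ?_⟩
  · rw [map_div₀, hcoeff, mul_div_cancel_right₀ _ hj']
  · apply map_injective (algebraMap ℚ K) (algebraMap ℚ K).injective
    rw [h, Polynomial.map_mul, map_C, map_div₀, hcoeff, mul_div_cancel_right₀ _ hj']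

/-- `Literature.AlgebraicGeometry.Motives.reflectScale` (`T^N A(r/T)`) commutes with extension of scalars `ℚ → L`. [folklore] -/
theorem map_reflectScale {L : Type*} [Field L] [CharZero L] (N : ℕ) (r : ℚ) (A : ℚ[X]) :
    (Literature.AlgebraicGeometry.Motives.reflectScale N r A).map (algebraMap ℚ L) =
      reflect N ((A.map (algebraMap ℚ L)).comp (C (algebraMap ℚ L r) * X)) := by
  rw [Literature.AlgebraicGeometry.Motives.reflectScale, ← reflect_map, Polynomial.map_comp, Polynomial.map_mul, map_C, map_X]

/-- A rational number `q₀` with `q₀² (qⁿ)^{d_A} = (qⁿ)^{d_B}` is `± q^{nχ/2}` in `ℝ`,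
`χ = d_B - d_A` (real `q^{nχ/2}` as in `Literature.AlgebraicGeometry.Motives.HasFunctionalEquation`; the sign is that of `q₀`).
[folklore] -/
theorem exists_sign_eq_rpow {q : ℕ} (hq : 0 < q) {n dA dB : ℕ} {χ : ℤ} (hχ : χ = (dB : ℤ) - dA)
    {q₀ : ℚ} (h : q₀ ^ 2 * ((q : ℚ) ^ n) ^ dA = ((q : ℚ) ^ n) ^ dB) :
    ∃ ε : ℤˣ, (q₀ : ℝ) = ((ε : ℤ) : ℝ) * (q : ℝ) ^ ((n : ℝ) * χ / 2) := by
  have hqR : (0 : ℝ) < q := Nat.cast_pos.mpr hq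
  have habs : |(q₀ : ℝ)| = (q : ℝ) ^ ((n : ℝ) * χ / 2) := by
    have h' : ((q₀ : ℝ)) ^ 2 * ((q : ℝ) ^ n) ^ dA = ((q : ℝ) ^ n) ^ dB := by exact_mod_cast h
    have hpos : (0 : ℝ) < ((q : ℝ) ^ n) ^ dA := by positivity
    have he : (n : ℝ) * (χ : ℝ) / 2 * 2 = ((n * dB : ℕ) : ℝ) - ((n * dA : ℕ) : ℝ) := by
      rw [hχ]; push_cast; ring
    rw [← sq_eq_sq₀ (abs_nonneg _) (Real.rpow_nonneg hqR.le _), sq_abs]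
    conv_rhs => rw [← Real.rpow_two, ← Real.rpow_mul hqR.le, he, Real.rpow_sub hqR,
      Real.rpow_natCast, Real.rpow_natCast]
    rw [eq_div_iff (by positivity), pow_mul, pow_mul]
    exact h'
  rcases le_or_gt 0 (q₀ : ℝ) with h0 | h0
  · refine ⟨1, ?_⟩
    rw [Units.val_one, Int.cast_one, one_mul, ← habs, abs_of_nonneg h0]
  · refine ⟨-1, ?_⟩
    rw [Units.val_neg, Units.val_one, Int.cast_neg, Int.cast_one, neg_one_mul, ← habs,
      abs_of_neg h0, neg_neg]

/-- **Grothendieck's functional equation, abstract form** (Hartshorne, App. C, Thm. 4.4; Kahn 2020,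
Thm. 3.65, (3.6.5)–(3.6.6)). Let `Z ∈ ℚ⟦T⟧` with a rational presentation `Z · B = A`
(`A, B ∈ ℚ[T]`, `B(0) ≠ 0`) and, over a field `K ⊇ ℚ`, a presentation `Z · B' = A'` by
polynomials with nonzero constant terms which are self-dual for `c = qⁿ`
(`A'^rev(qⁿT) = a A'`, `B'^rev(qⁿT) = b B'`; for `Z = Z(X, T)` these are `∏_{i odd} Pᵢ` and
`∏_{i even} Pᵢ`, `Pᵢ = det(1 - T F | Hⁱ(X))`, by Poincaré duality). Then
`Literature.HasFunctionalEquation q n Z (deg B - deg A)`: `Z(1/(qⁿT)) = ± q^{nχ/2} T^χ Z(T)` with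
`χ = deg B - deg A (= deg B' - deg A')`.
[cite: Hartshorne1977, App. C Thm. 4.4] [cite: Kahn2020, Thm. 3.65] -/
theorem hasFunctionalEquation_of_map {q n : ℕ} (hq : 0 < q) {Z : PowerSeries ℚ} {A B : ℚ[X]}
    (hB0 : B.coeff 0 ≠ 0) (hZ : Z * (B : PowerSeries ℚ) = A)
    {A' B' : K[X]} {a b : K} (hA'0 : A'.coeff 0 ≠ 0) (hB'0 : B'.coeff 0 ≠ 0)
    (hZ' : Z.map (algebraMap ℚ K) * (B' : PowerSeries K) = A')
    (hA' : A'.reverse.comp (C ((q : K) ^ n) * X) = C a * A')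
    (hB' : B'.reverse.comp (C ((q : K) ^ n) * X) = C b * B') :
    Literature.AlgebraicGeometry.Motives.HasFunctionalEquation q n Z ((B.natDegree : ℤ) - A.natDegree) := by
  -- notation
  set f := algebraMap ℚ K with hf
  set c : K := (q : K) ^ n with hc_def
  have hc : c ≠ 0 := pow_ne_zero _ (Nat.cast_ne_zero.mpr hq.ne')
  have hfc : f (((q : ℚ) ^ n)⁻¹) = c⁻¹ := by rw [map_inv₀, map_pow, map_natCast]
  have hB : B ≠ 0 := fun h => hB0 (by rw [h, coeff_zero])
  have hA'ne : A' ≠ 0 := fun h => hA'0 (by rw [h, coeff_zero])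
  have hB'ne : B' ≠ 0 := fun h => hB'0 (by rw [h, coeff_zero])
  -- the second presentation over `K`: `A_K · B' = A' · B_K`
  have hZK : Z.map f * ((B.map f : K[X]) : PowerSeries K) = (A.map f : K[X]) := by
    rw [Polynomial.polynomial_map_coe, Polynomial.polynomial_map_coe, ← map_mul, hZ]
  have hx : A.map f * B' = A' * B.map f := by
    apply Polynomial.coe_injective K
    rw [Polynomial.coe_mul, Polynomial.coe_mul, ← hZK, ← hZ']
    ring
  -- `A ≠ 0`
  have hA : A ≠ 0 := by
    intro hA
    apply hA'ne
    have hZ0 : Z = 0 := by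
      rcases mul_eq_zero.mp (hZ.trans (by rw [hA, Polynomial.coe_zero])) with h | h
      · exact h
      · exact absurd ((Polynomial.coe_eq_zero_iff).mp h) hB
    apply Polynomial.coe_injective K
    rw [← hZ', hZ0, map_zero, zero_mul, Polynomial.coe_zero]
  -- degrees
  have hdeg : (B.natDegree : ℤ) - A.natDegree = (B'.natDegree : ℤ) - A'.natDegree := by
    have h := congrArg natDegree hx
    rw [natDegree_mul ((Polynomial.map_ne_zero_iff f.injective).mpr hA) hB'ne,
      natDegree_mul hA'ne ((Polynomial.map_ne_zero_iff f.injective).mpr hB), natDegree_map,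
      natDegree_map] at h
    omega
  -- the functional equation over `K` for `(A', B')`, transferred to `(A_K, B_K)`
  set N := max A.natDegree B.natDegree with hN
  have hAN : (A.map f).natDegree ≤ N := (natDegree_map f (p := A)).le.trans (le_max_left _ _)
  have hBN : (B.map f).natDegree ≤ N := (natDegree_map f (p := B)).le.trans (le_max_right _ _)
  have hfeK :=
    functionalEquation_of_reverse_comp_eq hc hB'0 hA' hB' (le_max_left _ _) (le_max_right _ _)
  rw [← hdeg] at hfeK
  have hfeK' := functionalEquation_transfer hc hA'ne hB'ne (le_max_left _ _) (le_max_right _ _)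
    hAN hBN hx hfeK
  -- read it as the image of a rational identity
  have hL : (X ^ (-((B.natDegree : ℤ) - A.natDegree)).toNat *
        Literature.AlgebraicGeometry.Motives.reflectScale N ((q : ℚ) ^ n)⁻¹ A * B).map f =
      X ^ (-((B.natDegree : ℤ) - A.natDegree)).toNat *
        reflect N ((A.map f).comp (C c⁻¹ * X)) * B.map f := by
    rw [Polynomial.map_mul, Polynomial.map_mul, Polynomial.map_pow, map_X, map_reflectScale, hfc]
  have hR : (X ^ ((B.natDegree : ℤ) - A.natDegree).toNat * A *
        Literature.AlgebraicGeometry.Motives.reflectScale N ((q : ℚ) ^ n)⁻¹ B).map f =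
      X ^ ((B.natDegree : ℤ) - A.natDegree).toNat * A.map f *
        reflect N ((B.map f).comp (C c⁻¹ * X)) := by
    rw [Polynomial.map_mul, Polynomial.map_mul, Polynomial.map_pow, map_X, map_reflectScale, hfc]
  rw [mul_assoc (C _) (X ^ _), mul_assoc (C _)] at hfeK'
  rw [← hL, ← hR] at hfeK'
  have hRne :
      X ^ ((B.natDegree : ℤ) - A.natDegree).toNat * A * Literature.AlgebraicGeometry.Motives.reflectScale N ((q : ℚ) ^ n)⁻¹ B ≠ 0 := by
    refine mul_ne_zero (mul_ne_zero (pow_ne_zero _ X_ne_zero) hA) ?_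
    rw [Literature.AlgebraicGeometry.Motives.reflectScale, Ne, reflect_eq_zero_iff, comp_C_mul_X_eq_zero_iff
      (mem_nonZeroDivisors_of_ne_zero (inv_ne_zero (pow_ne_zero _ (Nat.cast_ne_zero.mpr hq.ne'))))]
    exact hB
  obtain ⟨q₀, hq₀, hLR⟩ := exists_eq_C_mul_of_map_eq hRne hfeK'
  -- the constant: `q₀² (qⁿ)^{deg A'} = (qⁿ)^{deg B'}`
  have hsqK := functionalEquation_const_sq hc hA'0 hB'0 hA' hB'
  rw [← hq₀, hc_def, ← map_natCast f, ← map_pow, ← map_pow, ← map_pow, ← map_pow, ← map_mul]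
    at hsqK
  have hsq : q₀ ^ 2 * ((q : ℚ) ^ n) ^ A'.natDegree = ((q : ℚ) ^ n) ^ B'.natDegree :=
    f.injective hsqK
  obtain ⟨ε, hε⟩ := exists_sign_eq_rpow hq hdeg hsq
  -- conclusion
  refine ⟨A, B, N, ε, hB0, hZ, le_max_left _ _, le_max_right _ _, ?_⟩
  have := congrArg (Polynomial.map (algebraMap ℚ ℝ)) hLR
  rw [Polynomial.map_mul, Polynomial.map_mul, Polynomial.map_pow, map_X, Polynomial.map_mul,
    map_C, Polynomial.map_mul, Polynomial.map_mul, Polynomial.map_pow, map_X, eq_ratCast, hε]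
    at this
  rw [this]
  ring

end Descent

/-! ### The cohomological input: Poincaré duality for the Frobenius characteristic polynomials -/

section Cohomology

open CategoryTheory _root_.AlgebraicGeometry

variable {k : Type u} [Field k] [Finite k] {K : Type v} [Field K] [CharZero K]
  {χ : Field.absoluteGaloisGroup k →* Kˣ} (E : Literature.AlgebraicGeometry.Motives.GaloisWeilCohomology k K χ)

/-- **`F = qⁿ` on `H²ⁿ(X)`** (Deligne, *Weil I*, (2.5)(c); Kahn 2020, sentence before (3.6.4)):
for a Galois Weil cohomology theory whose character satisfies `χ(φ) = q` on the arithmetic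
Frobenius and `X` smooth projective of dimension `n`, `tr(F y) = qⁿ tr(y)` for `y ∈ H²ⁿ(X)`,
`F = φ⁻¹` the geometric Frobenius (from the axiom `trace_ρ`: `tr(χ(g)ⁿ g y) = tr y`).
[cite: Deligne1974, (2.5)] [cite: Kahn2020, (3.6.4)] -/
theorem trace_frobAction (hχ : (χ (Literature.AlgebraicGeometry.Motives.arithFrob k) : K) = Nat.card k) {n : ℕ} {Y : Literature.AlgebraicGeometry.Motives.SchemeOver k}
    (hX : Literature.AlgebraicGeometry.Motives.IsSmoothProjective n Y) (y : E.obj Y (2 * n)) :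
    E.trace Y n (E.frobAction Y (2 * n) y) = ((Nat.card k : K) ^ n) * E.trace Y n y := by
  have h := E.trace_ρ hX (Literature.AlgebraicGeometry.Motives.geomFrob k) y
  rw [LinearMap.map_smul, smul_eq_mul] at h
  have hunit : ((χ (Literature.AlgebraicGeometry.Motives.geomFrob k) : K) ^ (n : ℤ)) * (Nat.card k : K) ^ n = 1 := by
    rw [Literature.AlgebraicGeometry.Motives.geomFrob, map_inv, Units.val_inv_eq_inv_val, hχ, zpow_natCast, ← mul_pow,
      inv_mul_cancel₀ (Nat.cast_ne_zero.mpr Nat.card_pos.ne'), one_pow]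
  rw [Literature.AlgebraicGeometry.Motives.GaloisWeilCohomology.frobAction_def, ← h, ← mul_assoc, mul_comm ((Nat.card k : K) ^ n),
    hunit, one_mul]

/-- **Kahn 2020, (3.6.4)** (Hartshorne, App. C, proof of Thm. 4.4; Deligne, *Weil I*, (2.4)–(2.5)):
the geometric Frobenius is "almost unitary" for the Poincaré pairing,
`⟨F v, F w⟩ = tr(F(v ∪ w)) = qⁿ ⟨v, w⟩` on `Hⁱ(X) × H²ⁿ⁻ⁱ(X)` (`cup_ρ` and `trace_frobAction`).
[cite: Kahn2020, (3.6.4)] [cite: Deligne1974, (2.4)] -/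
theorem cupPairing_frobAction (hχ : (χ (Literature.AlgebraicGeometry.Motives.arithFrob k) : K) = Nat.card k) {n : ℕ}
    {Y : Literature.AlgebraicGeometry.Motives.SchemeOver k} (hX : Literature.AlgebraicGeometry.Motives.IsSmoothProjective n Y) {i j : ℕ} (h : i + j = 2 * n)
    (v : E.obj Y i) (w : E.obj Y j) :
    E.cupPairing Y n i j h (E.frobAction Y i v) (E.frobAction Y j w) =
      ((Nat.card k : K) ^ n) * E.cupPairing Y n i j h v w := by
  rw [Literature.AlgebraicGeometry.Motives.PreWeilCohomology.cupPairing, LinearMap.compr₂_apply, LinearMap.compr₂_apply,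
    Literature.AlgebraicGeometry.Motives.GaloisWeilCohomology.frobAction_def, Literature.AlgebraicGeometry.Motives.GaloisWeilCohomology.frobAction_def,
    ← E.cup_ρ hX h (Literature.AlgebraicGeometry.Motives.geomFrob k) v w, ← Literature.AlgebraicGeometry.Motives.GaloisWeilCohomology.frobAction_def,
    trace_frobAction E hχ hX]

/-- **Poincaré duality for the polynomials `Pᵢ(X, T) = det(1 - T F | Hⁱ(X))`** (Hartshorne, App. C,
proof of Thm. 4.4: `P_{2n-i}(t) = (-1)^{Bᵢ} q^{nBᵢ} t^{Bᵢ} det(f*; Hⁱ)⁻¹ Pᵢ(1/(qⁿt))`; Kahn 2020,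
(3.6.5); Deligne, *Weil I*, (2.4): the eigenvalues of `F` on `H²ⁿ⁻ⁱ` are the `qⁿ αⱼ⁻¹`): for
`i + j = 2n` there is `κ ∈ K` (namely `(-1)^{bᵢ} det(F | Hⁱ)`) with `Pᵢ^rev(qⁿ T) = κ · Pⱼ(T)`.
From `charpoly_comp_C_mul_X_of_pairing` applied to the Poincaré pairing
(`E.isPerfPair_cupPairing`) and `cupPairing_frobAction`.
[cite: Hartshorne1977, App. C Thm. 4.4] [cite: Kahn2020, (3.6.5)] [cite: Deligne1974, (2.4)] -/
theorem reverse_frobCharPoly_comp (hχ : (χ (Literature.AlgebraicGeometry.Motives.arithFrob k) : K) = Nat.card k) {n : ℕ}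
    {Y : Literature.AlgebraicGeometry.Motives.SchemeOver k} (hX : Literature.AlgebraicGeometry.Motives.IsSmoothProjective n Y) {i j : ℕ} (h : i + j = 2 * n) :
    ∃ κ : K, (E.frobCharPoly Y i).reverse.comp (C ((Nat.card k : K) ^ n) * X) =
      C κ * E.frobCharPoly Y j := by
  haveI := E.finite_obj hX i
  haveI := E.finite_obj hX j
  haveI := E.isPerfPair_cupPairing hX i j h
  have hc : ((Nat.card k : K) ^ n) ≠ 0 := pow_ne_zero _ (Nat.cast_ne_zero.mpr Nat.card_pos.ne')
  obtain ⟨hkey, hdet⟩ := charpoly_comp_C_mul_X_of_pairing (E.cupPairing Y n i j h)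
    (E.frobAction Y i) (E.frobAction Y j) _ (cupPairing_frobAction E hχ hX h)
  refine ⟨(-1) ^ Module.finrank K (E.obj Y i) * LinearMap.det (E.frobAction Y i), ?_⟩
  rw [E.frobCharPoly_of_finite Y i, E.frobCharPoly_of_finite Y j,
    reverse_reverse_of_coeff_zero_ne_zero, hkey, ← C_1, ← C_neg, ← C_pow, ← C_mul]
  rw [ne_eq, ← mul_right_inj' (pow_ne_zero (Module.finrank K (E.obj Y i))
    (neg_ne_zero.mpr one_ne_zero) : ((-1 : K) ^ Module.finrank K (E.obj Y i)) ≠ 0), mul_zero,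
    ← LinearMap.det_eq_sign_charpoly_coeff]
  exact hdet hc

/-- The products `∏_{i ≤ 2n, p i} Pᵢ(X, T)` over a set of degrees stable under `i ↦ 2n - i` (the odd
degrees, the even degrees) are self-dual: `(∏ Pᵢ)^rev(qⁿT) = κ · ∏ Pᵢ` (Hartshorne, App. C, proof of
Thm. 4.4, "substituting these in the formula of (4.2)"; Kahn 2020, "collecting (3.6.5) for
`i = 0, …, 2n`"). [cite: Kahn2020, (3.6.5)–(3.6.6)] -/
theorem reverse_prod_frobCharPoly_comp (hχ : (χ (Literature.AlgebraicGeometry.Motives.arithFrob k) : K) = Nat.card k) {n : ℕ}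
    {Y : Literature.AlgebraicGeometry.Motives.SchemeOver k} (hX : Literature.AlgebraicGeometry.Motives.IsSmoothProjective n Y) (p : ℕ → Prop) [DecidablePred p]
    (hp : ∀ i ≤ 2 * n, p i → p (2 * n - i)) :
    ∃ κ : K, (∏ i ∈ (Finset.range (2 * n + 1)).filter p, E.frobCharPoly Y i).reverse.comp
        (C ((Nat.card k : K) ^ n) * X) =
      C κ * ∏ i ∈ (Finset.range (2 * n + 1)).filter p, E.frobCharPoly Y i := by
  classical
  -- duality factor for each `i`
  have hex : ∀ i ∈ (Finset.range (2 * n + 1)).filter p, ∃ κ : K,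
      (E.frobCharPoly Y i).reverse.comp (C ((Nat.card k : K) ^ n) * X) =
        C κ * E.frobCharPoly Y (2 * n - i) := by
    intro i hi
    have hi' := Finset.mem_range_succ_iff.mp (Finset.mem_filter.mp hi).1
    exact reverse_frobCharPoly_comp E hχ hX (by omega)
  choose! κ hκ using hex
  refine ⟨∏ i ∈ (Finset.range (2 * n + 1)).filter p, κ i, ?_⟩
  rw [reverse_prod, Polynomial.prod_comp, Finset.prod_congr rfl hκ, Finset.prod_mul_distrib,
    map_prod]
  congr 1
  -- reindex by the involution `i ↦ 2n - i`
  refine Finset.prod_nbij' (fun i => 2 * n - i) (fun i => 2 * n - i) ?_ ?_ ?_ ?_ ?_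
  · intro i hi
    obtain ⟨hi1, hi2⟩ := Finset.mem_filter.mp hi
    exact Finset.mem_filter.mpr
      ⟨Finset.mem_range.mpr (by omega), hp i (Finset.mem_range_succ_iff.mp hi1) hi2⟩
  · intro i hi
    obtain ⟨hi1, hi2⟩ := Finset.mem_filter.mp hi
    exact Finset.mem_filter.mpr
      ⟨Finset.mem_range.mpr (by omega), hp i (Finset.mem_range_succ_iff.mp hi1) hi2⟩
  · intro i hi
    have := Finset.mem_range_succ_iff.mp (Finset.mem_filter.mp hi).1
    omega
  · intro i hi
    have := Finset.mem_range_succ_iff.mp (Finset.mem_filter.mp hi).1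
    omega
  · intro i hi
    rfl

/-- `(∏ Pᵢ(X, T))(0) = 1` (`Pᵢ(X, 0) = 1`, `E.coeff_zero_frobCharPoly`). [folklore] -/
theorem coeff_zero_prod_frobCharPoly {n : ℕ} (Y : Literature.AlgebraicGeometry.Motives.SchemeOver k) (p : ℕ → Prop)
    [DecidablePred p] :
    (∏ i ∈ (Finset.range (2 * n + 1)).filter p, E.frobCharPoly Y i).coeff 0 = 1 := by
  rw [coeff_zero_prod]
  exact Finset.prod_eq_one fun i _ => E.coeff_zero_frobCharPoly Y i

end Cohomology

end WeilFunctionalEquation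

namespace WeilFunctionalEquation

/-! ### Rationality of a rational power series over an extension field -/

section Rationality

variable {K : Type*} [Field K] [CharZero K]

/-- Applying a `ℚ`-linear functional `π : K → ℚ` to the coefficients of a polynomial over `K`
gives a polynomial over `ℚ`. [folklore] -/
theorem exists_coeff_eq_dual_apply (π : Module.Dual ℚ K) (P : K[X]) :
    ∃ Q : ℚ[X], ∀ m, Q.coeff m = π (P.coeff m) := by
  classical
  refine ⟨∑ j ∈ Finset.range (P.natDegree + 1), C (π (P.coeff j)) * X ^ j, fun m => ?_⟩
  rw [finsetSum_coeff]
  simp only [coeff_C_mul_X_pow]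
  rw [Finset.sum_ite_eq]
  split_ifs with hm
  · rfl
  · rw [coeff_eq_zero_of_natDegree_lt (by simpa [Finset.mem_range, Nat.lt_succ_iff] using hm),
      map_zero]

/-- **Rationality descends** (Deligne, *Weil I*, proof of (1.7) ⟹ (1.6); Hartshorne, App. C,
after Thm. 4.2: `ℚ⟦t⟧ ∩ ℚ_ℓ(t) = ℚ(t)`; Kahn 2020, proof of Thm. 3.65). If a rational power
series `Z ∈ ℚ⟦T⟧` becomes a rational function over an extension field `K ⊇ ℚ`,
`Z · B' = A'` with `A', B' ∈ K[T]`, `B'(0) ≠ 0`, then already `Z · B = A` with `A, B ∈ ℚ[T]`,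
`B(0) ≠ 0`. Proof (instead of Hankel determinants): apply a `ℚ`-linear functional `π : K → ℚ`
with `π(B'(0)) ≠ 0` to the coefficients; since the coefficients of `Z` are rational,
`Z · π(B') = π(Z · B') = π(A')`.
[cite: Hartshorne1977, App. C Thm. 4.2] [cite: Deligne1974, (1.7)] -/
theorem exists_rat_presentation {Z : PowerSeries ℚ} {A' B' : K[X]} (hB'0 : B'.coeff 0 ≠ 0)
    (hZ' : Z.map (algebraMap ℚ K) * (B' : PowerSeries K) = A') :
    ∃ A B : ℚ[X], B.coeff 0 ≠ 0 ∧ Z * (B : PowerSeries ℚ) = A := by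
  classical
  obtain ⟨π, hπ⟩ := Module.Projective.exists_dual_ne_zero ℚ hB'0
  obtain ⟨B, hB⟩ := exists_coeff_eq_dual_apply π B'
  obtain ⟨A, hA⟩ := exists_coeff_eq_dual_apply π A'
  refine ⟨A, B, by rwa [hB 0], PowerSeries.ext fun m => ?_⟩
  have h := congrArg (PowerSeries.coeff m) hZ'
  rw [PowerSeries.coeff_mul, Polynomial.coeff_coe] at h
  rw [PowerSeries.coeff_mul, Polynomial.coeff_coe, hA, ← h, map_sum]
  refine Finset.sum_congr rfl fun p _ => ?_
  rw [Polynomial.coeff_coe, hB, PowerSeries.coeff_map, Polynomial.coeff_coe, ← Algebra.smul_def,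
    LinearMap.map_smul, smul_eq_mul]

/-- the Euler characteristic is presentation independent: if `Z · B = A` over `ℚ` (`B(0) ≠ 0`) and
`Z · B' = A'` over `K ⊇ ℚ` (`A'(0), B'(0) ≠ 0`), then `deg B - deg A = deg B' - deg A'`.
[folklore] -/
theorem natDegree_sub_natDegree_eq {Z : PowerSeries ℚ} {A B : ℚ[X]} (hB0 : B.coeff 0 ≠ 0)
    (hZ : Z * (B : PowerSeries ℚ) = A) {A' B' : K[X]} (hA'0 : A'.coeff 0 ≠ 0)
    (hB'0 : B'.coeff 0 ≠ 0) (hZ' : Z.map (algebraMap ℚ K) * (B' : PowerSeries K) = A') :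
    (B.natDegree : ℤ) - A.natDegree = (B'.natDegree : ℤ) - A'.natDegree := by
  set f := algebraMap ℚ K with hf
  have hB : B ≠ 0 := fun h => hB0 (by rw [h, coeff_zero])
  have hA'ne : A' ≠ 0 := fun h => hA'0 (by rw [h, coeff_zero])
  have hB'ne : B' ≠ 0 := fun h => hB'0 (by rw [h, coeff_zero])
  have hZK : Z.map f * ((B.map f : K[X]) : PowerSeries K) = (A.map f : K[X]) := by
    rw [Polynomial.polynomial_map_coe, Polynomial.polynomial_map_coe, ← map_mul, hZ]
  have hx : A.map f * B' = A' * B.map f := by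
    apply Polynomial.coe_injective K
    rw [Polynomial.coe_mul, Polynomial.coe_mul, ← hZK, ← hZ']
    ring
  have hA : A ≠ 0 := by
    intro hA
    apply hA'ne
    have hZ0 : Z = 0 := by
      rcases mul_eq_zero.mp (hZ.trans (by rw [hA, Polynomial.coe_zero])) with h | h
      · exact h
      · exact absurd ((Polynomial.coe_eq_zero_iff).mp h) hB
    apply Polynomial.coe_injective K
    rw [← hZ', hZ0, map_zero, zero_mul, Polynomial.coe_zero]
  have h := congrArg natDegree hx
  rw [natDegree_mul ((Polynomial.map_ne_zero_iff f.injective).mpr hA) hB'ne,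
    natDegree_mul hA'ne ((Polynomial.map_ne_zero_iff f.injective).mpr hB), natDegree_map,
    natDegree_map] at h
  omega

end Rationality

section Betti

open CategoryTheory _root_.AlgebraicGeometry

variable {k : Type u} [Field k] [Finite k] {K : Type v} [Field K] [CharZero K]
  {χ : Field.absoluteGaloisGroup k →* Kˣ} (E : Literature.AlgebraicGeometry.Motives.GaloisWeilCohomology k K χ)

/-- `deg Pᵢ(X, T) = bᵢ = dim Hⁱ(X)` for `i ≤ 2n` (the Frobenius is invertible on `Hⁱ(X)`:
`det F ≠ 0` by Poincaré duality; Hartshorne, App. C, after Thm. 4.2, "`Bᵢ = degree Pᵢ(t)`";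
Kahn 2020, (3.6.3)). [cite: Kahn2020, (3.6.3)] -/
theorem natDegree_frobCharPoly (hχ : (χ (Literature.AlgebraicGeometry.Motives.arithFrob k) : K) = Nat.card k) {n : ℕ}
    {Y : Literature.AlgebraicGeometry.Motives.SchemeOver k} (hX : Literature.AlgebraicGeometry.Motives.IsSmoothProjective n Y) {i : ℕ} (hi : i ≤ 2 * n) :
    (E.frobCharPoly Y i).natDegree = Module.finrank K (E.obj Y i) := by
  have hij : i + (2 * n - i) = 2 * n := by omega
  haveI := E.finite_obj hX i
  haveI := E.finite_obj hX (2 * n - i)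
  haveI := E.isPerfPair_cupPairing hX i (2 * n - i) hij
  have hc : ((Nat.card k : K) ^ n) ≠ 0 := pow_ne_zero _ (Nat.cast_ne_zero.mpr Nat.card_pos.ne')
  obtain ⟨-, hdet⟩ := charpoly_comp_C_mul_X_of_pairing (E.cupPairing Y n i (2 * n - i) hij)
    (E.frobAction Y i) (E.frobAction Y (2 * n - i)) _ (cupPairing_frobAction E hχ hX hij)
  have h0 : (E.frobAction Y i).charpoly.natTrailingDegree = 0 := by
    refine natTrailingDegree_eq_zero.mpr (Or.inr ?_)
    rw [ne_eq, ← mul_right_inj' (pow_ne_zero (Module.finrank K (E.obj Y i))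
      (neg_ne_zero.mpr one_ne_zero) : ((-1 : K) ^ Module.finrank K (E.obj Y i)) ≠ 0), mul_zero,
      ← LinearMap.det_eq_sign_charpoly_coeff]
    exact hdet hc
  rw [E.frobCharPoly_of_finite Y i, reverse_natDegree, h0, Nat.sub_zero,
    LinearMap.charpoly_natDegree]

end Betti

end WeilFunctionalEquation

section GaloisWeilCohomology
open Literature.AlgebraicGeometry.Motives (GaloisWeilCohomology)
open Literature.AlgebraicGeometry.Motives.GaloisWeilCohomology

open CategoryTheory _root_.AlgebraicGeometry WeilFunctionalEquation

variable {k : Type u} [Field k] [Finite k] {K : Type v} [Field K] [CharZero K]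
  {χ : Field.absoluteGaloisGroup k →* Kˣ} (E : GaloisWeilCohomology k K χ)

/-- **Rationality of `Z(X, T)` for smooth projective `X` from the cohomological formalism**
(Grothendieck, Sém. Bourbaki 279, Cor. 5.2; Hartshorne, App. C, Thm. 4.2 and the remark
`ℚ⟦t⟧ ∩ ℚ_ℓ(t) = ℚ(t)` following it; Kahn 2020, Thm. 3.65): if `E` satisfies the Lefschetz trace
formula then `Z(X, T) · B = A` for some `A, B ∈ ℚ[T]`, `B(0) ≠ 0` (`exists_rat_presentation`
applied to `Z · ∏_{even} Pᵢ = ∏_{odd} Pᵢ`). This is the smooth projective case of the named fact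
`Literature.NumberTheory.LFunctions.exists_polynomial_mul_zetaSeries_eq` (stated there for all schemes of finite type).
[cite: Grothendieck1965, Cor. 5.2] [cite: Hartshorne1977, App. C Thm. 4.2] -/
theorem _root_.Literature.AlgebraicGeometry.Motives.GaloisWeilCohomology.exists_polynomial_mul_zetaSeries_eq_of_hasLefschetzTraceFormula
    (hE : E.HasLefschetzTraceFormula) {n : ℕ} {Y : Literature.AlgebraicGeometry.Motives.SchemeOver k} (hX : Literature.AlgebraicGeometry.Motives.IsSmoothProjective n Y) :
    ∃ A B : ℚ[X], B.coeff 0 ≠ 0 ∧ Literature.AlgebraicGeometry.Motives.zetaSeries Y * (B : PowerSeries ℚ) = A := by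
  classical
  have hZK := E.zetaSeries_mul_prod_frobCharPoly_holds hE hX
  rw [← coe_prod, ← coe_prod] at hZK
  exact exists_rat_presentation
    (ne_of_eq_of_ne (coeff_zero_prod_frobCharPoly E Y Even (n := n)) one_ne_zero) hZK

/-- **Grothendieck's functional equation for a Weil cohomology theory** (Deligne, *Weil I*, (2.6):
`χ(X) = ∑ (-1)ⁱ dim Hⁱ(X)`, `Z(X₀, t) = ε q^{-nχ/2} t^{-χ} Z(X₀, q⁻ⁿ t⁻¹)`; Kahn 2020, Thm. 3.65 and
(3.6.6); Hartshorne, App. C, Thm. 4.4 with `E = ∑ (-1)ⁱ Bᵢ`). If the Galois Weil cohomology theory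
`E` over the finite field `k` (`q = #k`) satisfies the Lefschetz trace formula and `χ(φ) = q`,
then for every smooth projective `X` of dimension `n`,
`Z(X, 1/(qⁿT)) = ± q^{nχ(X)/2} T^{χ(X)} Z(X, T)` with `χ(X) = ∑_{i ≤ 2n} (-1)ⁱ dim_K Hⁱ(X)`, in the
cross-multiplied rational form `Literature.AlgebraicGeometry.Motives.HasFunctionalEquation` (rationality of `Z(X, T)` included:
`exists_rat_presentation`). Unconditional in the Weil factorisation, unlike the named fact
`Literature.NumberTheory.LFunctions.hasFunctionalEquation_zetaSeries`. [cite: Deligne1974, (2.6)] [cite: Kahn2020, Thm. 3.65]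
[cite: Hartshorne1977, App. C Thm. 4.4] -/
theorem _root_.Literature.AlgebraicGeometry.Motives.GaloisWeilCohomology.hasFunctionalEquation_zetaSeries_of_hasLefschetzTraceFormula
    (hE : E.HasLefschetzTraceFormula)
    (hχ : (χ (Literature.AlgebraicGeometry.Motives.arithFrob k) : K) = Nat.card k) {n : ℕ} {Y : Literature.AlgebraicGeometry.Motives.SchemeOver k}
    (hX : Literature.AlgebraicGeometry.Motives.IsSmoothProjective n Y) :
    Literature.AlgebraicGeometry.Motives.HasFunctionalEquation (Nat.card k) n (Literature.AlgebraicGeometry.Motives.zetaSeries Y)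
      (∑ i ∈ Finset.range (2 * n + 1), (-1 : ℤ) ^ i * (Module.finrank K (E.obj Y i) : ℤ)) := by
  classical
  obtain ⟨a, ha⟩ := reverse_prod_frobCharPoly_comp E hχ hX Odd fun i hi ho => by
    rcases ho with ⟨m, rfl⟩; exact ⟨n - m - 1, by omega⟩
  obtain ⟨b, hb⟩ := reverse_prod_frobCharPoly_comp E hχ hX Even fun i hi he => by
    rcases he with ⟨m, rfl⟩; exact ⟨n - m, by omega⟩
  have hZK := E.zetaSeries_mul_prod_frobCharPoly_holds hE hX
  rw [← coe_prod, ← coe_prod] at hZK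
  have hA'0 := ne_of_eq_of_ne (coeff_zero_prod_frobCharPoly E Y Odd (n := n)) one_ne_zero
  have hB'0 := ne_of_eq_of_ne (coeff_zero_prod_frobCharPoly E Y Even (n := n)) one_ne_zero
  obtain ⟨A, B, hB0, hZ⟩ := exists_rat_presentation hB'0 hZK
  have hfe := hasFunctionalEquation_of_map Nat.card_pos hB0 hZ hA'0 hB'0 hZK ha hb
  have hdeg := natDegree_sub_natDegree_eq hB0 hZ hA'0 hB'0 hZK
  -- `deg ∏_{even} Pᵢ - deg ∏_{odd} Pᵢ = ∑ (-1)ⁱ bᵢ`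
  have hne : ∀ i, E.frobCharPoly Y i ≠ 0 := fun i h => by
    have := E.coeff_zero_frobCharPoly Y i
    rw [h, coeff_zero] at this
    exact zero_ne_one this
  have hχ' : (∑ i ∈ Finset.range (2 * n + 1), (-1 : ℤ) ^ i * (Module.finrank K (E.obj Y i) : ℤ)) =
      (B.natDegree : ℤ) - A.natDegree := by
    rw [hdeg, natDegree_prod _ _ fun i _ => hne i, natDegree_prod _ _ fun i _ => hne i,
      ← Finset.sum_filter_add_sum_filter_not (Finset.range (2 * n + 1)) (fun i => Even i),
      Nat.cast_sum, Nat.cast_sum]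
    have hdegP : ∀ i ∈ Finset.range (2 * n + 1),
        ((E.frobCharPoly Y i).natDegree : ℤ) = Module.finrank K (E.obj Y i) := fun i hi => by
      rw [natDegree_frobCharPoly E hχ hX (Finset.mem_range_succ_iff.mp hi)]
    rw [Finset.sum_congr rfl fun i hi => by
        rw [(Finset.mem_filter.mp hi).2.neg_one_pow, one_mul,
          ← hdegP i (Finset.mem_filter.mp hi).1],
      Finset.sum_congr (Finset.filter_congr fun i _ => Nat.not_even_iff_odd) fun i hi => by
        rw [(Finset.mem_filter.mp hi).2.neg_one_pow, neg_one_mul,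
          ← hdegP i (Finset.mem_filter.mp hi).1],
      Finset.sum_neg_distrib]
    ring
  rwa [hχ']

end GaloisWeilCohomology

/-! ### The reduction of Grothendieck's functional equation to the cohomological formalism -/

section RH

open CategoryTheory _root_.AlgebraicGeometry WeilFunctionalEquation

variable {k : Type u} [Field k] [Finite k] {K : Type v} [Field K] [CharZero K]
  {χ : Field.absoluteGaloisGroup k →* Kˣ}

/-- **Grothendieck's functional equation of the zeta function, from the cohomological formalism**
(Grothendieck, Sém. Bourbaki 279 (1964/65), §5; Deligne, *Weil I* (1974), (2.6), "la formulation
de Grothendieck de l'équation fonctionnelle des fonctions Z"; Hartshorne, App. C, Thm. 4.4 "the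
functional equation follows from Poincaré duality"; Kahn 2020, Thm. 3.65 "if there exists a Weil
cohomology on `V(𝔽_q)` … the functional equation holds"). Let `E` be a Weil cohomology theory
with Galois action on smooth projective `k`-varieties, `k` finite with `q` elements, satisfying
the Lefschetz trace formula and with `χ(φ) = q` for the arithmetic Frobenius `φ` (both hold for
`ℓ`-adic étale cohomology, `ℓ ∤ q`, with the cyclotomic character). Then the named fact
`Literature.NumberTheory.LFunctions.hasFunctionalEquation_zetaSeries` holds over `k`: for `X` smooth projective of dimension
`n` and any Weil factorisation `(Pᵢ)` of `Z(X, T)`, `Z(1/(qⁿT)) = ± q^{nχ/2} T^χ Z(T)` with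
`χ = ∑ (-1)ⁱ deg Pᵢ`. Proof: steps 1–4 of the module docstring;
`χ = deg ∏_{even} Pᵢ - deg ∏_{odd} Pᵢ` for the given factorisation equals the same difference for
the cohomological presentation. [cite: Grothendieck1965, §5] [cite: Deligne1974, (2.6)]
[cite: Hartshorne1977, App. C Thm. 4.4] [cite: Kahn2020, Thm. 3.65] -/
theorem hasFunctionalEquation_zetaSeries_of_galoisWeilCohomology (E : Literature.AlgebraicGeometry.Motives.GaloisWeilCohomology k K χ)
    (hE : E.HasLefschetzTraceFormula) (hχ : (χ (Literature.AlgebraicGeometry.Motives.arithFrob k) : K) = Nat.card k) :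
    hasFunctionalEquation_zetaSeries (k := k) := by
  intro n Y hX P hP
  classical
  obtain ⟨hP0, hZ, -, -, -⟩ := hP
  -- the rational presentation `Z · B = A`
  set A : ℚ[X] := ∏ i ∈ (Finset.univ : Finset (Fin (2 * n + 1))) with Odd i.val,
    (P i).map (Int.castRingHom ℚ) with hA
  set B : ℚ[X] := ∏ i ∈ (Finset.univ : Finset (Fin (2 * n + 1))) with Even i.val,
    (P i).map (Int.castRingHom ℚ) with hB
  have hZ' : Literature.AlgebraicGeometry.Motives.zetaSeries Y * (B : PowerSeries ℚ) = A := by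
    rw [hA, hB, coe_prod, coe_prod]
    exact hZ
  have hPi : ∀ i, (P i).map (Int.castRingHom ℚ) ≠ 0 := fun i h => by
    have := congrArg (fun p : ℚ[X] => p.coeff 0) h
    simp [Polynomial.coeff_map, hP0 i] at this
  have hB0 : B.coeff 0 ≠ 0 := by
    rw [hB, coeff_zero_prod,
      Finset.prod_eq_one fun i _ => by rw [Polynomial.coeff_map, hP0 i, map_one]]
    exact one_ne_zero
  -- the Euler characteristic
  have hχ' : (∑ i : Fin (2 * n + 1), (-1 : ℤ) ^ (i : ℕ) * ((P i).natDegree : ℤ)) =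
      (B.natDegree : ℤ) - A.natDegree := by
    rw [hA, hB, natDegree_prod _ _ fun i _ => hPi i, natDegree_prod _ _ fun i _ => hPi i,
      ← Finset.sum_filter_add_sum_filter_not Finset.univ (fun i : Fin (2 * n + 1) => Even i.val),
      Nat.cast_sum, Nat.cast_sum]
    simp only [natDegree_map_eq_of_injective (Int.castRingHom ℚ).injective_int]
    rw [Finset.sum_congr rfl fun i hi => by rw [(Finset.mem_filter.mp hi).2.neg_one_pow, one_mul],
      Finset.sum_congr (Finset.filter_congr fun i _ => Nat.not_even_iff_odd) fun i hi => by
        rw [(Finset.mem_filter.mp hi).2.neg_one_pow, neg_one_mul],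
      Finset.sum_neg_distrib]
    ring
  rw [hχ']
  -- the cohomological presentation over `K`
  obtain ⟨a, ha⟩ := reverse_prod_frobCharPoly_comp E hχ hX Odd fun i hi ho => by
    rcases ho with ⟨m, rfl⟩; exact ⟨n - m - 1, by omega⟩
  obtain ⟨b, hb⟩ := reverse_prod_frobCharPoly_comp E hχ hX Even fun i hi he => by
    rcases he with ⟨m, rfl⟩; exact ⟨n - m, by omega⟩
  have hZK := E.zetaSeries_mul_prod_frobCharPoly_holds hE hX
  rw [← coe_prod, ← coe_prod] at hZK
  exact hasFunctionalEquation_of_map Nat.card_pos hB0 hZ'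
    (ne_of_eq_of_ne (coeff_zero_prod_frobCharPoly E Y Odd) one_ne_zero)
    (ne_of_eq_of_ne (coeff_zero_prod_frobCharPoly E Y Even) one_ne_zero) hZK ha hb

end RH

end Literature.NumberTheory.LFunctions

end
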